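import Literature.ModelTheory.ExponentialFields.RestrictedAnalyticSeries
import Literature.ModelTheory.ExponentialFields.RealAnTerms
import HarnessLib

/-!
# Restricted analytic functions are quantifier-free definable in `(ℝ_an, ⁻¹)`

Topic `Literature/ModelTheory/ExponentialFields`.  The bridge between the two formalizations of
"restricted analytic" in this directory:

* `RestrictedAnalytic n` (`RealAnExp.lean`, the function symbols `an f` of `Language.realAnExp`;
  Pila 2022, 8.21): a function real analytic in Mathlib's sense on a neighbourhood of `[0,1]ⁿ`,
  interpreted by `RestrictedAnalytic.restrict` (the function on the cube, `0` outside);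
* the Denef–van den Dries term language of `(ℝ_an, ⁻¹)` (`RealAnTerms.lean`: `Term`, built from
  global power series `GlobalSeries m` on `[-1,1]ᵐ`, and its quantifier-free sets `IsQF`;
  Denef–van den Dries 1988, §4).

**Every restricted analytic function is piecewise a term, and its graph (as the graph of
`restrict`) is a quantifier-free definable set of `(ℝ_an, ⁻¹)`**
(`RestrictedAnalytic.exists_finset_cover_terms`, `RestrictedAnalytic.isQF_graph_restrict`): by
`RestrictedAnalyticSeries.lean` the cube is covered by finitely many boxes `|v - a| ≤ cₐ` on which
`f(v) = Pₐ(v - a)` for a power series with `‖Pₐ‖_ρ < ∞`, `cₐ < ρ`, and such a germ is the term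
`Term.ofGerm` (`RealAnTerms.lean`, `Term.eval_ofGerm`); the graph of `restrict` is then the finite
Boolean combination "(`v` in the cube and, for some `a`, `|v - a| ≤ cₐ` and `y = tₐ(v)`) or (`v`
outside the cube and `y = 0`)" of sign conditions on terms.  Hence every quantifier-free definable
set of `ℝ_an,exp` built without `exp` is quantifier-free definable in `(ℝ_an, ⁻¹)` — the entrance
of the theory of `ℝ_an` (its o-minimality, Denef–van den Dries 1988) into the o-minimality of
`ℝ_an,exp` (`RealAnExpOMinimalProofs.lean`).  Nothing here is a named fact.

## References

* [Pila2022] J. Pila, *Point-counting and the Zilber–Pink conjecture* (2022), 8.21.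
* [DenefvandenDries1988] J. Denef, L. van den Dries, Ann. of Math. 128 (1988), §4.
-/

noncomputable section

open Set
open scoped NNReal ENNReal

namespace Literature.ModelTheory.ExponentialFields

open Literature.RingTheory.MvPowerSeries

namespace RestrictedAnalytic

variable {n : ℕ}

/-- **A restricted analytic function is piecewise a term of `(ℝ_an, ⁻¹)`**: there are finitely
many centres `a`, radii `cₐ > 0` and terms `tₐ` with `tₐ(v) = f(v)` whenever `|vᵢ - aᵢ| ≤ cₐ` for
all `i`, the boxes `|v - a| ≤ cₐ` covering the closed unit cube. [cite: DenefvandenDries1988, §4] -/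
theorem exists_finset_cover_terms (f : RestrictedAnalytic n) :
    ∃ (s : Finset (Fin n → ℝ)) (c : (Fin n → ℝ) → ℝ≥0) (t : (Fin n → ℝ) → Term (Fin n)),
      (∀ a ∈ s, 0 < c a ∧ ∀ v : Fin n → ℝ, (∀ i, |v i - a i| ≤ c a) → (t a).eval v = f.toFun v) ∧
      Set.Icc (0 : Fin n → ℝ) 1 ⊆ ⋃ a ∈ s, {v : Fin n → ℝ | ∀ i, |v i - a i| ≤ c a} := by
  classical
  obtain ⟨s, ρ, P, -, hs, hcover⟩ := f.exists_finset_cover_series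
  -- on the pieces `a ∈ s` the rescaled germ is a global series
  have hglob : ∀ a ∈ s, IsGlobal (scaledSeries (ρ a / 3) (P a)) := fun a ha =>
    isGlobal_scaledSeries (div_pos (hs a ha).1 (by norm_num))
      (div_lt_self (hs a ha).1 (by norm_num)) (hs a ha).2.1
  refine ⟨s, fun a => ρ a / 3,
    fun a => if ha : a ∈ s then Term.ofGerm (ρ a / 3) (P a) (hglob a ha) a else Term.const 0,
    fun a ha => ⟨div_pos (hs a ha).1 (by norm_num), fun v hv => ?_⟩, ?_⟩
  · dsimp only at hv ⊢
    rw [dif_pos ha, Term.eval_ofGerm (div_pos (hs a ha).1 (by norm_num)) (hglob a ha) a hv]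
    refine (hs a ha).2.2 v fun i => ?_
    have h1 : ‖v i - a i‖₊ ≤ ρ a / 3 := by
      rw [← NNReal.coe_le_coe, coe_nnnorm, Real.norm_eq_abs]
      exact hv i
    exact h1.trans (div_le_self zero_le (by norm_num))
  · refine hcover.trans (Set.iUnion₂_mono fun a _ v hv i => ?_)
    have h := hv i
    rwa [← NNReal.coe_le_coe, coe_nnnorm, Real.norm_eq_abs] at h

/-- **The graph of a restricted analytic function is quantifier-free definable in `(ℝ_an, ⁻¹)`**:
for `f : RestrictedAnalytic n`, the set `{(v, y) ∈ ℝⁿ⁺¹ | f.restrict v = y}` (with `restrict` the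
function on `[0,1]ⁿ` and `0` outside, the interpretation of the symbol `an f` of `ℝ_an,exp`) is
sign-decided by finitely many terms of the Denef–van den Dries language (`IsQF`).
[cite: DenefvandenDries1988, §4] -/
theorem isQF_graph_restrict (f : RestrictedAnalytic n) :
    IsQF {p : Fin (n + 1) → ℝ | f.restrict (Fin.init p) = p (Fin.last n)} := by
  classical
  obtain ⟨s, c, t, hs, hcover⟩ := f.exists_finset_cover_terms
  -- the vocabulary: coordinates `xᵢ`, the value `y`, the lifted terms `t̂ₐ`
  set x : Fin n → Term (Fin (n + 1)) := fun i => Term.var (Fin.castSucc i) with hx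
  set y : Term (Fin (n + 1)) := Term.var (Fin.last n) with hy
  set th : (Fin n → ℝ) → Term (Fin (n + 1)) := fun a => (t a).subst x with hth
  have hth_eval : ∀ a (p : Fin (n + 1) → ℝ), (th a).eval p = (t a).eval (Fin.init p) := by
    intro a p
    rw [hth, Term.eval_subst]
    rfl
  -- the pieces
  set C : Set (Fin (n + 1) → ℝ) := {p | Fin.init p ∈ Set.Icc (0 : Fin n → ℝ) 1} with hC
  set B : (Fin n → ℝ) → Set (Fin (n + 1) → ℝ) := fun a => {p | ∀ i, |Fin.init p i - a i| ≤ c a}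
    with hB
  set G : (Fin n → ℝ) → Set (Fin (n + 1) → ℝ) := fun a => {p | (th a).eval p = p (Fin.last n)}
    with hG
  set Z : Set (Fin (n + 1) → ℝ) := {p | p (Fin.last n) = 0} with hZ
  have hCqf : IsQF C := by
    have e : C = ⋂ i : Fin n, ({p : Fin (n + 1) → ℝ | 0 ≤ (x i).eval p} ∩
        {p | 0 ≤ (Term.sub (Term.const 1) (x i)).eval p}) := by
      ext p
      simp only [hC, hx, Set.mem_setOf_eq, Set.mem_Icc, Set.mem_iInter, Set.mem_inter_iff,
        Term.eval_var, Term.eval_sub, Term.eval_const, sub_nonneg, Pi.le_def, Pi.zero_apply,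
        Pi.one_apply]
      exact ⟨fun h i => ⟨h.1 i, h.2 i⟩, fun h => ⟨fun i => (h i).1, fun i => (h i).2⟩⟩
    rw [e]
    exact IsQF.iInter fun i => (isQF_setOf_nonneg _).inter (isQF_setOf_nonneg _)
  have hBqf : ∀ a, IsQF (B a) := by
    intro a
    have e : B a = ⋂ i : Fin n,
        ({p : Fin (n + 1) → ℝ | 0 ≤ (Term.sub (Term.const ((c a : ℝ) + a i)) (x i)).eval p} ∩
          {p | 0 ≤ (Term.sub (x i) (Term.const (a i - (c a : ℝ)))).eval p}) := by
      ext p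
      simp only [hB, hx, Set.mem_setOf_eq, Set.mem_iInter, Set.mem_inter_iff, Term.eval_var,
        Term.eval_sub, Term.eval_const, sub_nonneg, abs_le]
      refine forall_congr' fun i => ?_
      change (-(c a : ℝ) ≤ p (Fin.castSucc i) - a i ∧ p (Fin.castSucc i) - a i ≤ c a) ↔ _
      constructor
      · rintro ⟨h1, h2⟩; exact ⟨by linarith, by linarith⟩
      · rintro ⟨h1, h2⟩; exact ⟨by linarith, by linarith⟩
    rw [e]
    exact IsQF.iInter fun i => (isQF_setOf_nonneg _).inter (isQF_setOf_nonneg _)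
  have hGqf : ∀ a, IsQF (G a) := by
    intro a
    have e : G a = {p : Fin (n + 1) → ℝ | (Term.sub (th a) y).eval p = 0} := by
      ext p
      simp only [hG, hy, Set.mem_setOf_eq, Term.eval_sub, Term.eval_var, sub_eq_zero]
    rw [e]
    exact isQF_setOf_eq_zero _
  have hZqf : IsQF Z := by
    have e : Z = {p : Fin (n + 1) → ℝ | y.eval p = 0} := by
      ext p
      simp only [hZ, hy, Set.mem_setOf_eq, Term.eval_var]
    rw [e]
    exact isQF_setOf_eq_zero _
  -- the graph as a Boolean combination of the pieces
  have key : {p : Fin (n + 1) → ℝ | f.restrict (Fin.init p) = p (Fin.last n)} =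
      (C ∩ ⋃ a ∈ s, (B a ∩ G a)) ∪ (Cᶜ ∩ Z) := by
    ext p
    simp only [Set.mem_setOf_eq, Set.mem_union, Set.mem_inter_iff, Set.mem_compl_iff,
      Set.mem_iUnion, hC, hB, hG, hZ, exists_prop]
    by_cases hp : Fin.init p ∈ Set.Icc (0 : Fin n → ℝ) 1
    · rw [f.restrict_of_mem hp]
      constructor
      · intro hval
        obtain ⟨a, ha, hpa⟩ := Set.mem_iUnion₂.1 (hcover hp)
        refine Or.inl ⟨hp, a, ha, hpa, ?_⟩
        rw [hth_eval, (hs a ha).2 _ hpa, hval]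
      · rintro (⟨-, a, ha, hpa, hga⟩ | ⟨hnot, -⟩)
        · rw [← hga, hth_eval, (hs a ha).2 _ hpa]
        · exact absurd hp hnot
    · rw [f.restrict_of_not_mem hp]
      constructor
      · intro hval
        exact Or.inr ⟨hp, hval.symm⟩
      · rintro (⟨hmem, -⟩ | ⟨-, hz⟩)
        · exact absurd hmem hp
        · exact hz.symm
  rw [key]
  exact (hCqf.inter (IsQF.biUnion s fun a _ => (hBqf a).inter (hGqf a))).union (hCqf.compl.inter hZqf)

end RestrictedAnalytic

end Literature.ModelTheory.ExponentialFields

end
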